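import Summits.ValiantsHypothesis.ValiantsHypothesis.Theorems.DivisionGapSquareGridDimersDivisionEasyPropp

/-!
# Product decomposition of the dimer partition function along a vertex cut

If every edge with exactly one endpoint in `U` has weight `0`, then `Z univ = Z U * Z Uᶜ`
(`Z_univ_eq_Z_mul_Z_compl`): used to split the weighted Aztec diamond carrying the square grid into the
grid part and the four corner regions. [folklore]

All `def … : Prop` declarations in this file are decidable predicates on finite data (not named facts).
Support file for `SquareGridDimersDivisionEasy` (route DivisionGap, item stmt-ValiantsHypothesis-5072);
the closing theorem is `squareGridDimersDivisionEasy_proof` in `…DivisionGapSquareGridDimersDivisionEasy.lean`.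
-/

namespace Summit.ValiantsHypothesis.ValiantsHypothesis.Theorems

namespace SquareGridDimers

set_option linter.dupNamespace false

noncomputable section

open Finset

/-! ## Product decomposition along a vertex cut without crossing weights -/

/-- An edge *crosses* the vertex set `U` if exactly one of its endpoints lies in `U`. [folklore] -/
def Crosses {m : ℕ} (U : Finset (V m)) (e : E m) : Prop := (hEnd e ∈ U ↔ vEnd e ∉ U)

/-- Crossing is decidable. [folklore] -/
instance {m : ℕ} (U : Finset (V m)) (e : E m) : Decidable (Crosses U e) := by
  unfold Crosses; infer_instance

/-- Degree of a filtered edge set at a vertex of degree one. [folklore] -/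
theorem deg_filter_of_deg_eq_one {m : ℕ} (M : Finset (E m)) (P : E m → Prop) [DecidablePred P]
    (v : V m) {e₀ : E m} (h : M.filter (fun e => Inc e v) = {e₀}) :
    deg (M.filter P) v = if P e₀ then 1 else 0 := by
  classical
  unfold deg
  rw [filter_filter, show (M.filter fun e => P e ∧ Inc e v) = (M.filter fun e => Inc e v).filter P by
    rw [filter_filter]; congr 1; ext e; exact and_comm, h, filter_singleton]
  split_ifs <;> simp

/-- The unique edge of a perfect matching at a vertex of `U`. [folklore] -/
theorem exists_filter_eq_singleton {m : ℕ} {U : Finset (V m)} {M : Finset (E m)} (hM : IsPM U M)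
    {v : V m} (hv : v ∈ U) : ∃ e₀, M.filter (fun e => Inc e v) = {e₀} ∧ e₀ ∈ M ∧ Inc e₀ v := by
  classical
  have h1 : (M.filter fun e => Inc e v).card = 1 := by have := hM v; rw [if_pos hv] at this; exact this
  obtain ⟨e₀, he₀⟩ := card_eq_one.mp h1
  have : e₀ ∈ M.filter fun e => Inc e v := by rw [he₀]; exact mem_singleton_self _
  exact ⟨e₀, he₀, (mem_filter.mp this).1, (mem_filter.mp this).2⟩

/-- Splitting a perfect matching of everything without crossing edges along `U`: the `U`-part.
[folklore] -/
theorem isPM_filter_of_isPM_univ {m : ℕ} (U : Finset (V m)) {M : Finset (E m)} (hM : IsPM univ M)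
    (hnc : ∀ e ∈ M, ¬ Crosses U e) : IsPM U (M.filter fun e => hEnd e ∈ U) := by
  classical
  intro v
  obtain ⟨e₀, he₀, he₀M, hinc⟩ := exists_filter_eq_singleton hM (mem_univ v)
  rw [deg_filter_of_deg_eq_one M _ v he₀]
  have hc := hnc e₀ he₀M
  unfold Crosses at hc
  congr 1
  refine propext ?_
  rcases hinc with rfl | rfl
  · rfl
  · tauto

/-- Splitting a perfect matching of everything without crossing edges along `U`: the complementary
part. [folklore] -/
theorem isPM_filter_compl_of_isPM_univ {m : ℕ} (U : Finset (V m)) {M : Finset (E m)}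
    (hM : IsPM univ M) (hnc : ∀ e ∈ M, ¬ Crosses U e) :
    IsPM Uᶜ (M.filter fun e => hEnd e ∉ U) := by
  classical
  intro v
  obtain ⟨e₀, he₀, he₀M, hinc⟩ := exists_filter_eq_singleton hM (mem_univ v)
  rw [deg_filter_of_deg_eq_one M _ v he₀]
  simp only [mem_compl]
  have hc := hnc e₀ he₀M
  unfold Crosses at hc
  congr 1
  refine propext ?_
  rcases hinc with rfl | rfl
  · rfl
  · tauto

/-- Degrees add over disjoint unions. [folklore] -/
theorem deg_union {m : ℕ} {M₁ M₂ : Finset (E m)} (h : Disjoint M₁ M₂) (v : V m) :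
    deg (M₁ ∪ M₂) v = deg M₁ v + deg M₂ v := by
  classical
  unfold deg
  rw [filter_union, card_union_of_disjoint (disjoint_filter_filter h)]

/-- Gluing perfect matchings of `U` and of `Uᶜ`. [folklore] -/
theorem isPM_univ_union {m : ℕ} {U : Finset (V m)} {M₁ M₂ : Finset (E m)} (h₁ : IsPM U M₁)
    (h₂ : IsPM Uᶜ M₂) : Disjoint M₁ M₂ ∧ IsPM univ (M₁ ∪ M₂) := by
  classical
  have hd : Disjoint M₁ M₂ := by
    rw [disjoint_left]
    intro e he₁ he₂
    have a := (mem_of_isPM h₁ he₁).1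
    have b := (mem_of_isPM h₂ he₂).1
    exact (mem_compl.mp b) a
  refine ⟨hd, fun v => ?_⟩
  rw [deg_union hd, h₁ v, h₂ v]
  simp only [mem_compl, mem_univ, if_true]
  by_cases hv : v ∈ U <;> simp [hv]

/-- **Product decomposition.** If every edge crossing `U` has weight zero, the dimer partition
function of all vertices is the product of those of `U` and of its complement. [folklore] -/
theorem Z_univ_eq_Z_mul_Z_compl {m : ℕ} {F : Type*} [CommSemiring F] (U : Finset (V m))
    (ew : E m → F) (h0 : ∀ e, Crosses U e → ew e = 0) :
    Z univ ew = Z U ew * Z Uᶜ ew := by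
  classical
  -- drop the matchings with a crossing edge
  have step1 : Z univ ew = ∑ M ∈ (pmSet univ).filter (fun M => ∀ e ∈ M, ¬ Crosses U e),
      ∏ e ∈ M, ew e := by
    unfold Z
    rw [sum_filter]
    refine sum_congr rfl fun M _ => ?_
    split_ifs with h
    · rfl
    · simp only [not_forall, not_not, exists_prop] at h
      obtain ⟨e, he, hc⟩ := h
      exact prod_eq_zero he (h0 e hc)
  rw [step1, Z, Z, sum_mul_sum, ← sum_product']
  symm
  refine sum_bij' (fun MM _ => MM.1 ∪ MM.2)
    (fun M _ => (M.filter fun e => hEnd e ∈ U, M.filter fun e => hEnd e ∉ U)) ?_ ?_ ?_ ?_ ?_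
  · rintro ⟨M₁, M₂⟩ hMM
    rw [mem_product, mem_pmSet, mem_pmSet] at hMM
    obtain ⟨hd, hpm⟩ := isPM_univ_union hMM.1 hMM.2
    rw [mem_filter, mem_pmSet]
    refine ⟨hpm, fun e he hc => ?_⟩
    unfold Crosses at hc
    rcases mem_union.mp he with he | he
    · have := mem_of_isPM hMM.1 he; tauto
    · have := mem_of_isPM hMM.2 he
      rw [mem_compl, mem_compl] at this; tauto
  · intro M hM
    rw [mem_filter, mem_pmSet] at hM
    rw [mem_product, mem_pmSet, mem_pmSet]
    exact ⟨isPM_filter_of_isPM_univ U hM.1 hM.2, isPM_filter_compl_of_isPM_univ U hM.1 hM.2⟩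
  · rintro ⟨M₁, M₂⟩ hMM
    rw [mem_product, mem_pmSet, mem_pmSet] at hMM
    have a : ∀ e ∈ M₁, hEnd e ∈ U := fun e he => (mem_of_isPM hMM.1 he).1
    have b : ∀ e ∈ M₂, hEnd e ∉ U := fun e he => mem_compl.mp (mem_of_isPM hMM.2 he).1
    ext e <;> simp only [mem_filter, mem_union]
    · constructor
      · rintro ⟨h | h, h'⟩
        · exact h
        · exact absurd h' (b e h)
      · intro h; exact ⟨Or.inl h, a e h⟩
    · constructor
      · rintro ⟨h | h, h'⟩
        · exact absurd (a e h) h'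
        · exact h
      · intro h; exact ⟨Or.inr h, b e h⟩
  · intro M _
    exact filter_union_filter_not_eq _ M
  · rintro ⟨M₁, M₂⟩ hMM
    rw [mem_product, mem_pmSet, mem_pmSet] at hMM
    exact (prod_union (isPM_univ_union hMM.1 hMM.2).1).symm

end

end SquareGridDimers

end Summit.ValiantsHypothesis.ValiantsHypothesis.Theorems
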